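import Mathlib
import Summits.Ventures.FusionMHD.Models.CerfonFreidbergIterLikeQHalfResDefs
import HarnessLib

/-!
# Ventures/FusionMHD — Models/CerfonFreidbergIterLikeQHalfResPanels18.lean: KERNEL CHECK of the resistive-register certificates of panel(s) 30 (of 32)
# at `ψ_N = 1/2` of THE Cerfon–Freidberg ITER-like instance

HONEST FRAMING (LADDER-GRIDFUSION three columns; CF rung; rider «D_R at ψ_N = 1/2»).  One `decide +kernel` (≈ 60–90 s): for each listed panel the obligation
`CFIterLike.QHalfRes.ResCert.ok` (`Models/CerfonFreidbergIterLikeQHalfResDefs.lean`) — the Taylor-model run of `progR = progM ++ block3R` over ★ #117's parameter box is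
ACCEPTED and the kernel's two panel-integral enclosures (`g_AG`, `g_W` along the approximant) lie inside the claimed integers (compiled `#eval` of the same functions, slack
one unit of `2⁻⁶⁰`; float truth inside every panel, `genqm/truthR.json`).  MODELLED: analytic Cerfon–Freidberg family; nothing about a device or stability.
No `native_decide`.  Typer/prover: gridfusion-model-7 (g7), 2026-08-28.  Citations: Zheng 2015 §3.2 (3.42) [Zheng2015];
Mahboubi–Melquiond–Sibut-Pinote 2016 §3.2 Lemma 3 [MahboubiMelquiondSibutpinote2016].
-/

namespace Summit.Ventures.FusionMHD.Models.CFIterLike.QHalfRes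

/-- Resistive-register certificate data of panel(s) 30. [instance data] -/
def resCert18 : List ResCert := [
  { j := 30, cand1 := [770286583785756819456, -901700155134050566144, 10156892089973989179392, -11650597357616065675264, 66280321698044483469312, -51578477062413818527744, 154305697342915644227584, 331146421529519432138752, -1189807562257256106950656, 8617298446212839187152896, -2340586439724290815253544960, 130966184841000560732667904, 3167405478962240472012684263424],
    cand2 := [611557891446695002112, -432504888732044754944, 4867742021457654317056, -5552596332986606026752, 33030660595950337130496, -45183452697286898876416, 186678494825537104510976, -243810237538507461492736, 728632562566114645639168, -1998223487733706939957248, 73716304057615988379615232, 3799203098980619726803173376, -170554303045167744279656792064],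
    deg := 12, e1 := 43, e2 := 42, glo := 4619662454720854, ghi := 4619662610644961, wlo := 168239269749944682, whi := 168239274881937919 }]

/-- **KERNEL CHECK** of the two resistive registers on panel(s) 30. -/
theorem resCert18_ok : CFIterLike.QHalfRes.resCert18.all ResCert.ok = true := by
  decide +kernel

end Summit.Ventures.FusionMHD.Models.CFIterLike.QHalfRes
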